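import Summits.MatrixMultiplication.OmegaCensus.SmallFormats.MatMul22nPairingFactor
import Summits.MatrixMultiplication.OmegaCensus.SmallFormats.MatMul22nGramNondeg
import HarnessLib

/-!
# ω-census family (a): the (C-cell, R-cell) entry of `Q` is `±` the point pairing of its direction indices (`𝔽₃`)

Cell `pub-omega` (unit `pub-omega-tensor`, gen 40), topic `Summits/MatrixMultiplication/OmegaCensus` (sub-folder
`SmallFormats`). Framing (verbatim): lottery ticket; floor = certified bounds/negative ranges. HONEST FRAMING: M1-LEAN-BLUEPRINT F6 glue, type (C s, R t) («F6 DESIGN»):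
for terms `s, t` in different rows and columns of the obstruction normal form with `W_s` rows `= Ω`-combinations of the column plane `b` (`det Ω ≠ 0`) and `G_t` rows
`= A`-combinations of the row plane `c` (`det A ≠ 0`), a singular non-zero Gram block, `s` cheap for row `d` and `t` cheap for column `e`, the entry
`∑_{p,q} Y q p (W_s p ⬝ᵥ G_t q)` is `± ∑_{p,q} Y q p · rep d p · rep e q` (`PairingCR.Q_eq_pair_or_neg`). Nothing here is a bound on `ω`.
-/

namespace Summit.MatrixMultiplication.OmegaCensus.SmallFormats

open Finset Matrix
open Literature.Computability.AlgebraicComplexity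
open Summit.MatrixMultiplication.OmegaCensus.RankOnePlaneCapGeneral

namespace PairingCR

variable {ι : Type*} [Fintype ι] {n : ℕ}

omit [Fintype ι] in
/-- Over `𝔽₃`: a non-zero vector orthogonal to `ν_d = (−rep d 1, rep d 0)` is `± rep d`. -/
theorem eq_rep_or_neg_of_nu_dot (x : Fin 2 → ZMod 3) (d : Fin 4) (hx : x ≠ 0) (h : (![-((![![1, 0], ![0, 1], ![1, 1], ![1, 2]] : Fin 4 → Fin 2 → ZMod 3) d 1), (![![1, 0], ![0, 1], ![1, 1], ![1, 2]] : Fin 4 → Fin 2 → ZMod 3) d 0] : Fin 2 → ZMod 3) ⬝ᵥ x = 0) :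
    x = (![![1, 0], ![0, 1], ![1, 1], ![1, 2]] : Fin 4 → Fin 2 → ZMod 3) d ∨ x = -(![![1, 0], ![0, 1], ![1, 1], ![1, 2]] : Fin 4 → Fin 2 → ZMod 3) d := by
  refine PairingFactor.eq_rep_or_neg x d hx ?_
  have h' : (![-((![![1, 0], ![0, 1], ![1, 1], ![1, 2]] : Fin 4 → Fin 2 → ZMod 3) d 1), (![![1, 0], ![0, 1], ![1, 1], ![1, 2]] : Fin 4 → Fin 2 → ZMod 3) d 0] : Fin 2 → ZMod 3) ⬝ᵥ x = -(x 0 * (![![1, 0], ![0, 1], ![1, 1], ![1, 2]] : Fin 4 → Fin 2 → ZMod 3) d 1 - x 1 * (![![1, 0], ![0, 1], ![1, 1], ![1, 2]] : Fin 4 → Fin 2 → ZMod 3) d 0) := by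
    simp [dotProduct, Fin.sum_univ_two]; ring
  rw [h'] at h
  exact neg_eq_zero.mp h

/-- **(C, R) entry.** -/
theorem Q_eq_pair_or_neg (β : BilinComp (mulBilin (ZMod 3) 2 2 n) ι) (Y : Matrix (Fin 2) (Fin 2) (ZMod 3)) (s t : ι)
    (b c : Fin 2 → (Fin n → ZMod 3)) (Ω A : Matrix (Fin 2) (Fin 2) (ZMod 3))
    (hW : ∀ p, β.w s p = ∑ l, Ω p l • b l) (hG : ∀ q, (fun jj => β.g t (Matrix.single q jj (1 : ZMod 3))) = ∑ l, A q l • c l)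
    (hΩ : Ω.det ≠ 0) (hA : A.det ≠ 0)
    (x : Fin 2 → ZMod 3) (hx : x ≠ 0) (hnull : ∀ m, (∑ l, x l • c l) ⬝ᵥ b m = 0) (hblk : ∃ l m, c l ⬝ᵥ b m ≠ 0)
    (d e : Fin 4) (hcheapW : ∀ m, ∑ i, c m i * (Matrix.vecMul (![-((![![1, 0], ![0, 1], ![1, 1], ![1, 2]] : Fin 4 → Fin 2 → ZMod 3) d 1), (![![1, 0], ![0, 1], ![1, 1], ![1, 2]] : Fin 4 → Fin 2 → ZMod 3) d 0] : Fin 2 → ZMod 3) (β.w s)) i = 0)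
    (hcheapG : ∀ m, β.g t (Matrix.vecMulVec (![-((![![1, 0], ![0, 1], ![1, 1], ![1, 2]] : Fin 4 → Fin 2 → ZMod 3) e 1), (![![1, 0], ![0, 1], ![1, 1], ![1, 2]] : Fin 4 → Fin 2 → ZMod 3) e 0] : Fin 2 → ZMod 3) (b m)) = 0) :
    (∑ p, ∑ q, Y q p * (β.w s p ⬝ᵥ (fun jj => β.g t (Matrix.single q jj (1 : ZMod 3))))) = ∑ p, ∑ q, Y q p * ((![![1, 0], ![0, 1], ![1, 1], ![1, 2]] : Fin 4 → Fin 2 → ZMod 3) d p * (![![1, 0], ![0, 1], ![1, 1], ![1, 2]] : Fin 4 → Fin 2 → ZMod 3) e q) ∨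
    (∑ p, ∑ q, Y q p * (β.w s p ⬝ᵥ (fun jj => β.g t (Matrix.single q jj (1 : ZMod 3))))) = -∑ p, ∑ q, Y q p * ((![![1, 0], ![0, 1], ![1, 1], ![1, 2]] : Fin 4 → Fin 2 → ZMod 3) d p * (![![1, 0], ![0, 1], ![1, 1], ![1, 2]] : Fin 4 → Fin 2 → ZMod 3) e q) := by
  classical
  -- the transposed Gram block `Pt l l' = b l ⬝ c l'` is non-zero and singular
  set Pt : Matrix (Fin 2) (Fin 2) (ZMod 3) := Matrix.of fun l l' => b l ⬝ᵥ c l' with hPt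
  have hPt0 : Pt ≠ 0 := by
    obtain ⟨l, m, hlm⟩ := hblk
    intro h0
    have := congrFun (congrFun h0 m) l
    rw [hPt, Matrix.of_apply, dotProduct_comm] at this
    exact hlm this
  have hPtdet : Pt.det = 0 := by
    -- x is a right null vector of Pt: (Pt *ᵥ x) m = ∑ l' (b m ⬝ c l') x l' = (∑ x l • c l) ⬝ b m = 0
    by_contra hdet
    have hmv : Matrix.mulVec Pt x = 0 := by
      funext m
      rw [Matrix.mulVec, dotProduct, Pi.zero_apply, ← hnull m, sum_dotProduct]
      refine Finset.sum_congr rfl fun l _ => ?_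
      rw [hPt, Matrix.of_apply, smul_dotProduct, smul_eq_mul, dotProduct_comm, mul_comm]
    exact hx (Matrix.eq_zero_of_mulVec_eq_zero hdet hmv)
  obtain ⟨lam, kap, hlam, hkap, hfac⟩ := PairingFactor.exists_outer_of_det_eq_zero Pt hPt0 hPtdet
  have hblock : ∀ l l', b l ⬝ᵥ c l' = lam l * kap l' := fun l l' => by rw [← hfac l l', hPt, Matrix.of_apply]
  -- factorisation of the pairings
  have hpair : ∀ p q, β.w s p ⬝ᵥ (fun jj => β.g t (Matrix.single q jj (1 : ZMod 3))) = (Matrix.mulVec Ω lam) p * (Matrix.mulVec A kap) q :=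
    PairingFactor.fac_of_block (Matrix.of fun p i => β.w s p i) (Matrix.of fun q jj => β.g t (Matrix.single q jj (1 : ZMod 3))) b c Ω A
      (fun p => by ext i; simp only [Matrix.of_apply]; rw [hW p]) (fun q => by ext jj; simp only [Matrix.of_apply]; exact congrFun (hG q) jj) lam kap hblock
  -- β := A kap is non-zero and orthogonal to ν_e
  have hβ0 : Matrix.mulVec A kap ≠ 0 := fun h => hkap (Matrix.eq_zero_of_mulVec_eq_zero hA h)
  have hβν : (![-((![![1, 0], ![0, 1], ![1, 1], ![1, 2]] : Fin 4 → Fin 2 → ZMod 3) e 1), (![![1, 0], ![0, 1], ![1, 1], ![1, 2]] : Fin 4 → Fin 2 → ZMod 3) e 0] : Fin 2 → ZMod 3) ⬝ᵥ Matrix.mulVec A kap = 0 := by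
    obtain ⟨m, hm⟩ := Function.ne_iff.mp hlam
    have h := hcheapG m
    rw [GramNondeg.g_cheapInput_eq_vecMul β t c b _ A hG m, Matrix.vecMul, dotProduct] at h
    -- ∑ l (ν ᵥ* A) l * (c l ⬝ b m) = lam m * (ν ⬝ A kap)
    have h' : ∑ l, Matrix.vecMul (![-((![![1, 0], ![0, 1], ![1, 1], ![1, 2]] : Fin 4 → Fin 2 → ZMod 3) e 1), (![![1, 0], ![0, 1], ![1, 1], ![1, 2]] : Fin 4 → Fin 2 → ZMod 3) e 0] : Fin 2 → ZMod 3) A l * (Matrix.of (fun l m => c l ⬝ᵥ b m) : Matrix (Fin 2) (Fin 2) (ZMod 3)) l m =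
        lam m * ((![-((![![1, 0], ![0, 1], ![1, 1], ![1, 2]] : Fin 4 → Fin 2 → ZMod 3) e 1), (![![1, 0], ![0, 1], ![1, 1], ![1, 2]] : Fin 4 → Fin 2 → ZMod 3) e 0] : Fin 2 → ZMod 3) ⬝ᵥ Matrix.mulVec A kap) := by
      rw [Fin.sum_univ_two]
      simp only [Matrix.of_apply]
      rw [dotProduct_comm (c 0) (b m), dotProduct_comm (c 1) (b m), hblock m 0, hblock m 1]
      simp only [Matrix.vecMul, Matrix.mulVec, dotProduct, Fin.sum_univ_two]
      simp
      ring
    rw [h'] at h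
    rcases mul_eq_zero.mp h with h1 | h1
    · exact absurd h1 hm
    · exact h1
  -- α := Ω lam is non-zero and orthogonal to ν_d
  have hα0 : Matrix.mulVec Ω lam ≠ 0 := fun h => hlam (Matrix.eq_zero_of_mulVec_eq_zero hΩ h)
  have hαν : (![-((![![1, 0], ![0, 1], ![1, 1], ![1, 2]] : Fin 4 → Fin 2 → ZMod 3) d 1), (![![1, 0], ![0, 1], ![1, 1], ![1, 2]] : Fin 4 → Fin 2 → ZMod 3) d 0] : Fin 2 → ZMod 3) ⬝ᵥ Matrix.mulVec Ω lam = 0 := by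
    obtain ⟨m, hm⟩ := Function.ne_iff.mp hkap
    have h := hcheapW m
    -- ∑_i c m i (ν ᵥ* W_s) i = ∑_p ν p (W_s p ⬝ c m) = kap m * (ν ⬝ Ω lam)
    have hrow : ∀ p, β.w s p ⬝ᵥ c m = (Matrix.mulVec Ω lam) p * kap m := by
      intro p
      rw [hW p, Fin.sum_univ_two, add_dotProduct, smul_dotProduct, smul_dotProduct, hblock 0 m, hblock 1 m]
      simp only [Matrix.mulVec, dotProduct, Fin.sum_univ_two, smul_eq_mul]
      ring
    have hmv : Matrix.mulVec (β.w s) (c m) = kap m • Matrix.mulVec Ω lam := by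
      funext p
      show β.w s p ⬝ᵥ c m = (kap m • Matrix.mulVec Ω lam) p
      rw [Pi.smul_apply, smul_eq_mul, hrow p, mul_comm]
    have h' : ∑ i, c m i * (Matrix.vecMul (![-((![![1, 0], ![0, 1], ![1, 1], ![1, 2]] : Fin 4 → Fin 2 → ZMod 3) d 1), (![![1, 0], ![0, 1], ![1, 1], ![1, 2]] : Fin 4 → Fin 2 → ZMod 3) d 0] : Fin 2 → ZMod 3) (β.w s)) i = kap m * ((![-((![![1, 0], ![0, 1], ![1, 1], ![1, 2]] : Fin 4 → Fin 2 → ZMod 3) d 1), (![![1, 0], ![0, 1], ![1, 1], ![1, 2]] : Fin 4 → Fin 2 → ZMod 3) d 0] : Fin 2 → ZMod 3) ⬝ᵥ Matrix.mulVec Ω lam) := by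
      have h1 : ∑ i, c m i * (Matrix.vecMul (![-((![![1, 0], ![0, 1], ![1, 1], ![1, 2]] : Fin 4 → Fin 2 → ZMod 3) d 1), (![![1, 0], ![0, 1], ![1, 1], ![1, 2]] : Fin 4 → Fin 2 → ZMod 3) d 0] : Fin 2 → ZMod 3) (β.w s)) i = (![-((![![1, 0], ![0, 1], ![1, 1], ![1, 2]] : Fin 4 → Fin 2 → ZMod 3) d 1), (![![1, 0], ![0, 1], ![1, 1], ![1, 2]] : Fin 4 → Fin 2 → ZMod 3) d 0] : Fin 2 → ZMod 3) ⬝ᵥ Matrix.mulVec (β.w s) (c m) := by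
        rw [Matrix.dotProduct_mulVec, dotProduct_comm]; rfl
      rw [h1, hmv, dotProduct_smul, smul_eq_mul]
    rw [h'] at h
    rcases mul_eq_zero.mp h with h1 | h1
    · exact absurd h1 hm
    · exact h1
  -- conclude
  have hα := eq_rep_or_neg_of_nu_dot _ d hα0 hαν
  have hβ' := eq_rep_or_neg_of_nu_dot _ e hβ0 hβν
  exact PairingFactor.Q_eq_pair_or_neg Y (Matrix.of fun p i => β.w s p i) (Matrix.of fun q jj => β.g t (Matrix.single q jj (1 : ZMod 3)))
    _ _ hpair d e hα hβ'

end PairingCR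

end Summit.MatrixMultiplication.OmegaCensus.SmallFormats
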